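import Summits.SmoothPoincare4.SmoothPoincare4.Theorems.AgkCor6Sufficiency.Negative.StablyTrivialTight

/-!
# `AgkCor6Sufficiency` — negative-side support III: triviality of the group is load-bearing

Companion of `StablyTrivialTight.lean` (crux item `stmt-SmoothPoincare4-10894`, work file
`Cruxes/AgkCor6Sufficiency/Disproof.lean` §6).  `zKernels` — the `(3,1)` trisection of
`S¹ × S³ # ℂP² # ℂP²` (handle `0` carries the genus-one trisection `(a,a,a)` of `S¹ × S³`, handles
`1, 2` the trisection `(a,b,ab)` of `ℂP²`; `χ = 2`, `π₁ = ℤ`) — is a `(3,1)` group trisection of its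
triple quotient (`zKernels_isGroupTrisection`), which is non-trivial (it surjects onto `ℤ/2` by the
indicator of `b₀`, `not_subsingleton_tripleQuotient_zKernels`), so it is NOT stably trivial
(`not_isStablyTrivial_zKernels`, by `isStablyTrivial_tight`).  Hence
`not_forall_isGroupTrisection_isStablyTrivial`: AGK's hypothesis with the numerics `(3k,k)` kept but
the group arbitrary is false — `χ = 2` alone does not force stable triviality.

References: A. Abrams, D. Gay, R. Kirby, *Group trisections and smooth 4-manifolds*, Geom. Topol.
22 (2018), Def. 1–3, Thm. 5, Cor. 6 (p. 1541); D. Gay, R. Kirby, *Trisecting 4-manifolds*, Geom.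
Topol. 20 (2016), §2 (genus-one trisections of `ℂP²`, `S¹ × S³`; connected sums).
-/

noncomputable section

namespace Summit.SmoothPoincare4.SmoothPoincare4.Theorems.AgkCor6Sufficiency.Negative

open Literature.Topology.FourManifolds Subgroup

/-! ## 6. Refuted strengthening II: triviality of the group is load-bearing
(the `(3,1)` trisection of `S¹ × S³ # ℂP² # ℂP²`, a group trisection of `ℤ`, is not stably trivial) -/

section AnyGroup

/-- Generators of `S_3`. [folklore] -/
abbrev za (i : Fin 3) : SurfaceGroup 3 := PresentedGroup.of (i, false)
/-- The generators `bᵢ` of `S_3`. [folklore] -/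
abbrev zb (i : Fin 3) : SurfaceGroup 3 := PresentedGroup.of (i, true)

/-- Kernel triple of the `(3,1)` trisection of `S¹ × S³ # ℂP² # ℂP²` (`π₁ = ℤ`, `χ = 2`):
handle 0 carries `(a, a, a)` (the genus-one trisection of `S¹ × S³`), handles 1, 2 carry `(a, b, ab)`
(`ℂP²`). [folklore] -/
def zKernels : TrisectionKernels 3 :=
  ![normalClosure {za 0, za 1, za 2}, normalClosure {za 0, zb 1, zb 2},
    normalClosure {za 0, za 1 * zb 1, za 2 * zb 2}]

/-- The first kernel `⟪a₀, a₁, a₂⟫`. [folklore] -/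
theorem zKernels_zero : zKernels 0 = normalClosure {za 0, za 1, za 2} := rfl
/-- The second kernel `⟪a₀, b₁, b₂⟫`. [folklore] -/
theorem zKernels_one : zKernels 1 = normalClosure {za 0, zb 1, zb 2} := rfl
/-- The third kernel `⟪a₀, a₁b₁, a₂b₂⟫`. [folklore] -/
theorem zKernels_two : zKernels 2 = normalClosure {za 0, za 1 * zb 1, za 2 * zb 2} := rfl

/-- The kernels are normal closures, hence normal. [folklore] -/
instance zKernels_normal (i : Fin 3) : (zKernels i).Normal := by
  fin_cases i <;> simp [zKernels] <;> infer_instance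

/-- `a₀` lies in every kernel. [folklore] -/
theorem za0_mem (i : Fin 3) : za 0 ∈ zKernels i := by
  fin_cases i <;> exact subset_normalClosure (by simp)
/-- `a₁ ∈ K₀`. [folklore] -/
theorem za1_mem_zero : za 1 ∈ zKernels 0 := subset_normalClosure (by simp)
/-- `a₂ ∈ K₀`. [folklore] -/
theorem za2_mem_zero : za 2 ∈ zKernels 0 := subset_normalClosure (by simp)
/-- `b₁ ∈ K₁`. [folklore] -/
theorem zb1_mem_one : zb 1 ∈ zKernels 1 := subset_normalClosure (by simp)
/-- `b₂ ∈ K₁`. [folklore] -/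
theorem zb2_mem_one : zb 2 ∈ zKernels 1 := subset_normalClosure (by simp)
/-- `a₁b₁ ∈ K₂`. [folklore] -/
theorem zab1_mem_two : za 1 * zb 1 ∈ zKernels 2 := subset_normalClosure (by simp)
/-- `a₂b₂ ∈ K₂`. [folklore] -/
theorem zab2_mem_two : za 2 * zb 2 ∈ zKernels 2 := subset_normalClosure (by simp)

/-- The `a`-curves `{a₀, a₁, a₂}` and the mixed system `{a₀, b₁, b₂}` as generator sets. [folklore] -/
def zGensA : Finset (surfaceGen 3) := {((0 : Fin 3), false), ((1 : Fin 3), false), ((2 : Fin 3), false)}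
/-- The mixed system `{a₀, b₁, b₂}`. [folklore] -/
def zGensB : Finset (surfaceGen 3) := {((0 : Fin 3), false), ((1 : Fin 3), true), ((2 : Fin 3), true)}
/-- Everything but `b₀` (killed by any two of the three kernels). [folklore] -/
def zGensPair : Finset (surfaceGen 3) := Finset.univ.erase ((0 : Fin 3), true)

/-- `zGensA` meets every handle. [folklore] -/
theorem zGensA_hits (k : Fin 3) : (k, false) ∈ zGensA ∨ (k, true) ∈ zGensA := by
  fin_cases k <;> decide
/-- `zGensB` meets every handle. [folklore] -/
theorem zGensB_hits (k : Fin 3) : (k, false) ∈ zGensB ∨ (k, true) ∈ zGensB := by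
  fin_cases k <;> decide
/-- `zGensPair` meets every handle. [folklore] -/
theorem zGensPair_hits (k : Fin 3) : (k, false) ∈ zGensPair ∨ (k, true) ∈ zGensPair := by
  fin_cases k <;> decide

/-- `S_3 / ⟪a₀, a₁, a₂⟫ ≅ F_3`. [folklore] -/
theorem isFreeOfRank_quotient_zKernels_zero : IsFreeOfRank (SurfaceGroup 3 ⧸ zKernels 0) 3 := by
  refine isFreeOfRank_quotient_of_erase (n := 3) zGensA zGensA_hits _ ?_ ?_ (by decide)
  · intro x hx
    simp only [zGensA, Finset.mem_insert, Finset.mem_singleton] at hx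
    rcases hx with rfl | rfl | rfl
    · exact za0_mem 0
    · exact za1_mem_zero
    · exact za2_mem_zero
  · rw [zKernels_zero]
    refine normalClosure_le_normal ?_
    simp only [Set.insert_subset_iff, Set.singleton_subset_iff, SetLike.mem_coe]
    exact ⟨of_mem_ker_eraseHom _ _ (by decide), of_mem_ker_eraseHom _ _ (by decide),
      of_mem_ker_eraseHom _ _ (by decide)⟩

/-- `S_3 / ⟪a₀, b₁, b₂⟫ ≅ F_3`. [folklore] -/
theorem isFreeOfRank_quotient_zKernels_one : IsFreeOfRank (SurfaceGroup 3 ⧸ zKernels 1) 3 := by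
  refine isFreeOfRank_quotient_of_erase (n := 3) zGensB zGensB_hits _ ?_ ?_ (by decide)
  · intro x hx
    simp only [zGensB, Finset.mem_insert, Finset.mem_singleton] at hx
    rcases hx with rfl | rfl | rfl
    · exact za0_mem 1
    · exact zb1_mem_one
    · exact zb2_mem_one
  · rw [zKernels_one]
    refine normalClosure_le_normal ?_
    simp only [Set.insert_subset_iff, Set.singleton_subset_iff, SetLike.mem_coe]
    exact ⟨of_mem_ker_eraseHom _ _ (by decide), of_mem_ker_eraseHom _ _ (by decide),
      of_mem_ker_eraseHom _ _ (by decide)⟩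

/-- Images of the `a`- and `b`-generators under `S_3 → F_3 = F⟨x₀,x₁,x₂⟩`:
`a₀ ↦ 1, a₁ ↦ x₁, a₂ ↦ x₂`, `b₀ ↦ x₀, b₁ ↦ x₁⁻¹, b₂ ↦ x₂⁻¹`. [folklore] -/
def zImgA : Fin 3 → FreeGroup (Fin 3) := ![1, FreeGroup.of 1, FreeGroup.of 2]
/-- Images of the `b`-generators: `b₀ ↦ x₀, b₁ ↦ x₁⁻¹, b₂ ↦ x₂⁻¹`. [folklore] -/
def zImgB : Fin 3 → FreeGroup (Fin 3) := ![FreeGroup.of 0, (FreeGroup.of 1)⁻¹, (FreeGroup.of 2)⁻¹]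

/-- Value of `zImgA` at `0`. [folklore] -/
@[simp] theorem zImgA_zero : zImgA 0 = 1 := rfl
/-- Value of `zImgA` at `1`. [folklore] -/
@[simp] theorem zImgA_one : zImgA 1 = FreeGroup.of 1 := rfl
/-- Value of `zImgA` at `2`. [folklore] -/
@[simp] theorem zImgA_two : zImgA 2 = FreeGroup.of 2 := rfl
/-- Value of `zImgB` at `0`. [folklore] -/
@[simp] theorem zImgB_zero : zImgB 0 = FreeGroup.of 0 := rfl
/-- Value of `zImgB` at `1`. [folklore] -/
@[simp] theorem zImgB_one : zImgB 1 = (FreeGroup.of 1)⁻¹ := rfl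
/-- Value of `zImgB` at `2`. [folklore] -/
@[simp] theorem zImgB_two : zImgB 2 = (FreeGroup.of 2)⁻¹ := rfl

/-- The hom `S_3 → F_3` killing `⟪a₀, a₁b₁, a₂b₂⟫`. [folklore] -/
def zHomTwo : SurfaceGroup 3 →* FreeGroup (Fin 3) :=
  PresentedGroup.toGroup (f := fun p => if p.2 then zImgB p.1 else zImgA p.1) (by
    intro r hr
    rw [Set.mem_singleton_iff] at hr
    subst hr
    simp [surfaceRelator, genA, genB, List.finRange_succ, Fin.succ])

/-- `zHomTwo` on the `a`-generators. [folklore] -/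
@[simp] theorem zHomTwo_za (i : Fin 3) : zHomTwo (za i) = zImgA i := by
  simp [zHomTwo, za]
/-- `zHomTwo` on the `b`-generators. [folklore] -/
@[simp] theorem zHomTwo_zb (i : Fin 3) : zHomTwo (zb i) = zImgB i := by
  simp [zHomTwo, zb]

/-- `K₂` dies under `zHomTwo`. [folklore] -/
theorem zKernels_two_le_ker : zKernels 2 ≤ zHomTwo.ker := by
  rw [zKernels_two]
  refine normalClosure_le_normal ?_
  simp only [Set.insert_subset_iff, Set.singleton_subset_iff, SetLike.mem_coe, MonoidHom.mem_ker,
    map_mul, zHomTwo_za, zHomTwo_zb]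
  simp

/-- The three survivors `b₀, a₁, a₂` in the quotient `S_3 / ⟪a₀, a₁b₁, a₂b₂⟫`. [folklore] -/
def zSurv : Fin 3 → SurfaceGroup 3 ⧸ zKernels 2 :=
  ![QuotientGroup.mk (zb 0), QuotientGroup.mk (za 1), QuotientGroup.mk (za 2)]

/-- Value of `zSurv` at `0`. [folklore] -/
@[simp] theorem zSurv_zero : zSurv 0 = QuotientGroup.mk (zb 0) := rfl
/-- Value of `zSurv` at `1`. [folklore] -/
@[simp] theorem zSurv_one : zSurv 1 = QuotientGroup.mk (za 1) := rfl
/-- Value of `zSurv` at `2`. [folklore] -/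
@[simp] theorem zSurv_two : zSurv 2 = QuotientGroup.mk (za 2) := rfl

/-- `S_3 / ⟪a₀, a₁b₁, a₂b₂⟫ ≅ F_3`. [folklore] -/
def quotientZKernelsTwoEquiv : SurfaceGroup 3 ⧸ zKernels 2 ≃* FreeGroup (Fin 3) :=
  MonoidHom.toMulEquiv (QuotientGroup.lift _ zHomTwo zKernels_two_le_ker) (FreeGroup.lift zSurv)
    (by
      apply QuotientGroup.monoidHom_ext
      apply PresentedGroup.ext
      rintro ⟨i, c⟩
      simp only [MonoidHom.comp_apply, MonoidHom.id_apply, QuotientGroup.mk'_apply,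
        QuotientGroup.lift_mk]
      fin_cases i <;> cases c
      · -- a₀ ↦ 1 ↦ 1 = [a₀]
        rw [show ((⟨0, by omega⟩ : Fin 3), false) = ((0 : Fin 3), false) from rfl, zHomTwo_za,
          zImgA_zero, map_one]
        exact ((QuotientGroup.eq_one_iff _).2 (za0_mem 2)).symm
      · rw [show ((⟨0, by omega⟩ : Fin 3), true) = ((0 : Fin 3), true) from rfl, zHomTwo_zb,
          zImgB_zero, FreeGroup.lift_apply_of, zSurv_zero]
      · rw [show ((⟨1, by omega⟩ : Fin 3), false) = ((1 : Fin 3), false) from rfl, zHomTwo_za,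
          zImgA_one, FreeGroup.lift_apply_of, zSurv_one]
      · rw [show ((⟨1, by omega⟩ : Fin 3), true) = ((1 : Fin 3), true) from rfl, zHomTwo_zb,
          zImgB_one, map_inv, FreeGroup.lift_apply_of, zSurv_one, ← QuotientGroup.mk_inv,
          QuotientGroup.eq, inv_inv]
        exact zab1_mem_two
      · rw [show ((⟨2, by omega⟩ : Fin 3), false) = ((2 : Fin 3), false) from rfl, zHomTwo_za,
          zImgA_two, FreeGroup.lift_apply_of, zSurv_two]
      · rw [show ((⟨2, by omega⟩ : Fin 3), true) = ((2 : Fin 3), true) from rfl, zHomTwo_zb,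
          zImgB_two, map_inv, FreeGroup.lift_apply_of, zSurv_two, ← QuotientGroup.mk_inv,
          QuotientGroup.eq, inv_inv]
        exact zab2_mem_two)
    (by
      apply FreeGroup.ext_hom
      intro i
      simp only [MonoidHom.comp_apply, MonoidHom.id_apply, FreeGroup.lift_apply_of]
      fin_cases i
      · rw [show (⟨0, by omega⟩ : Fin 3) = 0 from rfl, zSurv_zero, QuotientGroup.lift_mk, zHomTwo_zb,
          zImgB_zero]
      · rw [show (⟨1, by omega⟩ : Fin 3) = 1 from rfl, zSurv_one, QuotientGroup.lift_mk, zHomTwo_za,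
          zImgA_one]
      · rw [show (⟨2, by omega⟩ : Fin 3) = 2 from rfl, zSurv_two, QuotientGroup.lift_mk, zHomTwo_za,
          zImgA_two])


/-- Pairwise quotients of `zKernels`: any two kernels kill everything but `b₀`, so the quotient is
`F_1` — the three direct cases `(0,1)`, `(0,2)`, `(1,2)`. [folklore] -/
theorem isFreeOfRank_pairQuotient_zKernels_of_lt (i j : Fin 3) (hij : i < j) :
    IsFreeOfRank (zKernels.pairQuotient i j) 1 := by
  -- the normal closure of `K i ∪ K j`
  have hsub : ∀ l l' : Fin 3, (zKernels l : Set (SurfaceGroup 3)) ∪ zKernels l' ⊆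
      normalClosure ((zKernels l : Set (SurfaceGroup 3)) ∪ zKernels l') :=
    fun _ _ => subset_normalClosure
  -- every kernel is killed by erasing `zGensPair` (all generators but `b₀`)
  have hker : ∀ l, zKernels l ≤ (eraseHom zGensPair zGensPair_hits).ker := by
    intro l
    fin_cases l
    · rw [show (⟨0, by omega⟩ : Fin 3) = 0 from rfl, zKernels_zero]
      refine normalClosure_le_normal ?_
      simp only [Set.insert_subset_iff, Set.singleton_subset_iff, SetLike.mem_coe]
      exact ⟨of_mem_ker_eraseHom _ _ (by decide), of_mem_ker_eraseHom _ _ (by decide),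
        of_mem_ker_eraseHom _ _ (by decide)⟩
    · rw [show (⟨1, by omega⟩ : Fin 3) = 1 from rfl, zKernels_one]
      refine normalClosure_le_normal ?_
      simp only [Set.insert_subset_iff, Set.singleton_subset_iff, SetLike.mem_coe]
      exact ⟨of_mem_ker_eraseHom _ _ (by decide), of_mem_ker_eraseHom _ _ (by decide),
        of_mem_ker_eraseHom _ _ (by decide)⟩
    · rw [show (⟨2, by omega⟩ : Fin 3) = 2 from rfl, zKernels_two]
      refine normalClosure_le_normal ?_
      simp only [Set.insert_subset_iff, Set.singleton_subset_iff, SetLike.mem_coe]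
      exact ⟨of_mem_ker_eraseHom _ _ (by decide),
        mul_mem (of_mem_ker_eraseHom _ _ (by decide)) (of_mem_ker_eraseHom _ _ (by decide)),
        mul_mem (of_mem_ker_eraseHom _ _ (by decide)) (of_mem_ker_eraseHom _ _ (by decide))⟩
  have hN₂ : normalClosure ((zKernels i : Set (SurfaceGroup 3)) ∪ zKernels j) ≤
      (eraseHom zGensPair zGensPair_hits).ker :=
    normalClosure_le_normal (Set.union_subset (hker i) (hker j))
  -- the five erased generators lie in the normal closure, case by case
  have hN₁ : ∀ x ∈ zGensPair, (PresentedGroup.of x : SurfaceGroup 3) ∈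
      normalClosure ((zKernels i : Set (SurfaceGroup 3)) ∪ zKernels j) := by
    have ha0 : za 0 ∈ normalClosure ((zKernels i : Set (SurfaceGroup 3)) ∪ zKernels j) :=
      hsub _ _ (Or.inl (za0_mem i))
    fin_cases i <;> fin_cases j <;> try exact absurd hij (by decide)
    · -- (0,1)
      have ha1 := hsub 0 1 (Or.inl za1_mem_zero)
      have ha2 := hsub 0 1 (Or.inl za2_mem_zero)
      have hb1 := hsub 0 1 (Or.inr zb1_mem_one)
      have hb2 := hsub 0 1 (Or.inr zb2_mem_one)
      intro x hx
      fin_cases x <;> simp (config := {decide := true}) at hx <;> assumption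
    · -- (0,2)
      have ha1 := hsub 0 2 (Or.inl za1_mem_zero)
      have ha2 := hsub 0 2 (Or.inl za2_mem_zero)
      have hb1 : zb 1 ∈ normalClosure ((zKernels 0 : Set (SurfaceGroup 3)) ∪ zKernels 2) := by
        have h := mul_mem (inv_mem ha1) (hsub 0 2 (Or.inr zab1_mem_two))
        rwa [inv_mul_cancel_left] at h
      have hb2 : zb 2 ∈ normalClosure ((zKernels 0 : Set (SurfaceGroup 3)) ∪ zKernels 2) := by
        have h := mul_mem (inv_mem ha2) (hsub 0 2 (Or.inr zab2_mem_two))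
        rwa [inv_mul_cancel_left] at h
      intro x hx
      fin_cases x <;> simp (config := {decide := true}) at hx <;> assumption
    · -- (1,2)
      have hb1 := hsub 1 2 (Or.inl zb1_mem_one)
      have hb2 := hsub 1 2 (Or.inl zb2_mem_one)
      have ha1 : za 1 ∈ normalClosure ((zKernels 1 : Set (SurfaceGroup 3)) ∪ zKernels 2) := by
        have h := mul_mem (hsub 1 2 (Or.inr zab1_mem_two)) (inv_mem hb1)
        rwa [mul_inv_cancel_right] at h
      have ha2 : za 2 ∈ normalClosure ((zKernels 1 : Set (SurfaceGroup 3)) ∪ zKernels 2) := by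
        have h := mul_mem (hsub 1 2 (Or.inr zab2_mem_two)) (inv_mem hb2)
        rwa [mul_inv_cancel_right] at h
      intro x hx
      fin_cases x <;> simp (config := {decide := true}) at hx <;> assumption
  exact isFreeOfRank_quotient_of_erase (n := 1) zGensPair zGensPair_hits _ hN₁ hN₂ (by decide)

/-- **`zKernels` is a `(3,1)` group trisection of its (non-trivial) triple quotient `ℤ`.** [folklore] -/
theorem zKernels_isGroupTrisection : IsGroupTrisection 3 1 zKernels.tripleQuotient zKernels where
  normal := zKernels_normal
  free_quotient i := by
    rw [isFreeOfRank_quotient_normalClosure_iff]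
    fin_cases i
    · exact isFreeOfRank_quotient_zKernels_zero
    · exact isFreeOfRank_quotient_zKernels_one
    · exact ⟨quotientZKernelsTwoEquiv.symm⟩
  free_pairQuotient i j hij := by
    rcases lt_or_gt_of_ne hij with h | h
    · exact isFreeOfRank_pairQuotient_zKernels_of_lt i j h
    · exact isFreeOfRank_pairQuotient_symm (isFreeOfRank_pairQuotient_zKernels_of_lt j i h)
  triple := ⟨MulEquiv.refl _⟩

/-- The indicator of `b₀` into `ℤ/2`: a generator assignment killing all three kernels. [folklore] -/
def zDetect : surfaceGen 3 → Multiplicative (ZMod 2) :=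
  fun p => if p = ((0 : Fin 3), true) then Multiplicative.ofAdd 1 else 1

/-- Every kernel of `zKernels` dies under the `b₀`-indicator. [folklore] -/
theorem zKernels_le_ker_toCommGroup_zDetect (l : Fin 3) : zKernels l ≤ (SurfaceGroup.toCommGroup zDetect).ker := by
  fin_cases l
  · rw [show (⟨0, by omega⟩ : Fin 3) = 0 from rfl, zKernels_zero]
    refine normalClosure_le_normal ?_
    simp only [Set.insert_subset_iff, Set.singleton_subset_iff, SetLike.mem_coe, MonoidHom.mem_ker,
      SurfaceGroup.toCommGroup_of, zDetect]
    decide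
  · rw [show (⟨1, by omega⟩ : Fin 3) = 1 from rfl, zKernels_one]
    refine normalClosure_le_normal ?_
    simp only [Set.insert_subset_iff, Set.singleton_subset_iff, SetLike.mem_coe, MonoidHom.mem_ker,
      SurfaceGroup.toCommGroup_of, zDetect]
    decide
  · rw [show (⟨2, by omega⟩ : Fin 3) = 2 from rfl, zKernels_two]
    refine normalClosure_le_normal ?_
    simp only [Set.insert_subset_iff, Set.singleton_subset_iff, SetLike.mem_coe, MonoidHom.mem_ker,
      map_mul, SurfaceGroup.toCommGroup_of, zDetect]
    decide

/-- The triple quotient of `zKernels` surjects onto `ℤ/2` (it is `ℤ`, generated by `b₀`); in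
particular it is **not trivial**. [folklore] -/
theorem not_subsingleton_tripleQuotient_zKernels : ¬ Subsingleton zKernels.tripleQuotient := by
  intro hs
  have hle : normalClosure (⋃ l, (zKernels l : Set (SurfaceGroup 3))) ≤ (SurfaceGroup.toCommGroup zDetect).ker :=
    normalClosure_le_normal (Set.iUnion_subset fun l => zKernels_le_ker_toCommGroup_zDetect l)
  have h1 : (QuotientGroup.mk (zb 0) : zKernels.tripleQuotient) = 1 := Subsingleton.elim _ _
  have h2 := congrArg (QuotientGroup.lift _ (SurfaceGroup.toCommGroup zDetect) hle) h1
  rw [QuotientGroup.lift_mk, map_one, SurfaceGroup.toCommGroup_of] at h2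
  revert h2
  decide

/-- … hence `zKernels` is **not stably trivial** (`isStablyTrivial_tight`: the triple quotient of a
stably trivial triple is trivial). [folklore] -/
theorem not_isStablyTrivial_zKernels : ¬ zKernels.IsStablyTrivial := fun h => by
  obtain ⟨e⟩ := (isStablyTrivial_tight zKernels_isGroupTrisection h).2
  exact not_subsingleton_tripleQuotient_zKernels e.toEquiv.subsingleton

/-- **Refuted strengthening II (`G = 1` is load-bearing in AGK Cor. 6).**  With the numerics
`(3k, k)` but an arbitrary group, "every group trisection is stably trivial" is false: witness the
`(3,1)` trisection of `S¹ × S³ # ℂP² # ℂP²` (`χ = 2`, `π₁ = ℤ`).  So AGK's hypothesis genuinely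
lives on the trivial group: `χ = 2` alone does not force stable triviality.
[cite: AbramsGayKirby2018, Cor. 6 (p. 1541)] -/
theorem not_forall_isGroupTrisection_isStablyTrivial :
    ¬ ∀ (k : ℕ) (G : Type) [Group G] (K : TrisectionKernels (3 * k)),
      IsGroupTrisection (3 * k) k G K → K.IsStablyTrivial :=
  fun h => not_isStablyTrivial_zKernels (h 1 _ zKernels zKernels_isGroupTrisection)

end AnyGroup

end Summit.SmoothPoincare4.SmoothPoincare4.Theorems.AgkCor6Sufficiency.Negative

end
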